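import Literature.NumberTheory.EllipticCurves.GreenbergSelmerCharIdealPrincipalProofs
import Literature.NumberTheory.EllipticCurves.SharpFlatPAdicLFunctionCoeffField
import Mathlib.RingTheory.AdicCompletion.Noetherian
import Mathlib.RingTheory.PowerSeries.Ideal
import Mathlib.RingTheory.PowerSeries.Inverse
import HarnessLib

/-!
# Route `SignedLowerHalves`, crux L `SmallImageLowerHalfBothSigns` (stmt-BirchSwinnertonDyer-23599), line `rtt_w3` v30 — stub S3β″ (`stub_junctionPT_ns`), input N5-(iii) (unramified generator),
# algebraic component: KRULL ALONG THE TOWER IN `Λ_𝒪 = 𝒪⟦T⟧` — `⋂_{n,k} (I + (p^k, ω_n)) = I` for every ideal `I`, `ω_n = (1+T)^{pⁿ} − 1`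

WIDTH seat `bsd-line-slh-p3-w3` g26 under LEAD `cruxlead-stmt-BirchSwinnertonDyer-23599` g14 (cell `bsd-ssimc`); helper `--supports stmt-BirchSwinnertonDyer-23599`. THEOREMS ONLY.
HONEST FRAMING: pure commutative algebra. It is the step «`Ann(u_w) = ⋂_{n,k} Ann(u_{w,n,k}) = ⋂_{n,k} (P_w, p^k, ω_n) = (P_w)`» of the unramified-generator input of N5-(iii)
(`…RttD2SeqSemilocGenerator`, hypothesis `hgen`): the level `(n,k)` of `𝐇¹_{Iw,w}` is killed by `p^k` (`semilocCoh_torsion`) and by `ω_n` (`R_γ^{pⁿ} = 1`), so levelwise annihilators always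
contain `(p^k, ω_n)`, and this file removes them in the limit. `Λ_𝒪` is Noetherian local (`𝒪` a complete DVR, Mathlib `PowerSeries` instances), `(p^k, ω_k) ⊆ 𝔪^k`, and Krull's intersection theorem
(Mathlib `IsHausdorff (maximalIdeal _) M` for finitely generated `M = Λ_𝒪/I`). Nothing about S3β″, crux L or BSD is proved; all remain OPEN and are proved for NO curve.

* `C_natCast_mem_maximalIdeal`, `omegaT`, `omegaT_succ`, `omegaT_mem_maximalIdeal_pow` (`ω_n ∈ 𝔪^{n+1}`),
  `span_pair_le_maximalIdeal_pow`; ★★ `iInf_sup_span_pair_eq` (`⋂_m (I + (p^m, ω_m)) = I`) and ★★ `iInf_iInf_sup_span_pair_eq` (`⋂_{n,k} (I + (p^k, ω_n)) = I`).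
References: [Matsumura1987] Thm. 8.10 (Krull); [Washington1997] §7.1, §13.2; [NeukirchSchmidtWingberg2008] (5.3.5).
-/

set_option autoImplicit false
set_option linter.dupNamespace false -- D-0017: single-problem summit, the namespace repeats the problem name by design
noncomputable section

open scoped Classical

namespace Summit.BirchSwinnertonDyer.BirchSwinnertonDyer.Theorems.SmallImageRttD2Seq

open Literature.NumberTheory.EllipticCurves PowerSeries

variable {p : ℕ} [Fact p.Prime] (S : Set (PadicAlgCl p))

/-- `C(p) ∈ 𝔪_{Λ_𝒪}` (a power series is a unit iff its constant coefficient is). [cite: Washington1997, §7.1] -/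
theorem C_natCast_mem_maximalIdeal : haveI := isLocalRing_padicCoeffIntegers S
    (PowerSeries.C ((p : ℕ) : padicCoeffIntegers S) : IwasawaAlgebraO S) ∈ IsLocalRing.maximalIdeal (IwasawaAlgebraO S) := by
  haveI := isLocalRing_padicCoeffIntegers S
  rw [IsLocalRing.mem_maximalIdeal, mem_nonunits_iff, PowerSeries.isUnit_iff_constantCoeff, PowerSeries.constantCoeff_C]
  rw [padicCoeffIntegers_eq_unitBall S]
  exact Literature.NumberTheory.Automorphic.PadicIntermediateField.not_isUnit_natCast_prime p _

/-- **`ω_n = (1+T)^{pⁿ} − 1 ∈ Λ_𝒪`** (the element through which `γ^{pⁿ} − 1` acts; it kills every module on which `U_n` acts trivially). [cite: Washington1997, §7.1, §13.2] -/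
abbrev omegaT (n : ℕ) : IwasawaAlgebraO S := (1 + PowerSeries.X) ^ p ^ n - 1

/-- `ω_{n+1} = ω_n · Σ_{i<p} ((1+T)^{pⁿ})^i`. [cite: Washington1997, §7.1] -/
theorem omegaT_succ (n : ℕ) : omegaT S (n + 1) = omegaT S n * ∑ i ∈ Finset.range p, ((1 + PowerSeries.X : IwasawaAlgebraO S) ^ p ^ n) ^ i := by
  rw [omegaT, omegaT, mul_comm, geom_sum_mul, ← pow_mul, ← pow_succ]

/-- The cofactor `Σ_{i<p} ((1+T)^{pⁿ})^i` lies in `𝔪_{Λ_𝒪}` (its constant coefficient is `p`). [cite: Washington1997, §7.1] -/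
theorem geom_sum_mem_maximalIdeal (n : ℕ) : haveI := isLocalRing_padicCoeffIntegers S
    (∑ i ∈ Finset.range p, ((1 + PowerSeries.X : IwasawaAlgebraO S) ^ p ^ n) ^ i) ∈ IsLocalRing.maximalIdeal (IwasawaAlgebraO S) := by
  haveI := isLocalRing_padicCoeffIntegers S
  rw [IsLocalRing.mem_maximalIdeal, mem_nonunits_iff, PowerSeries.isUnit_iff_constantCoeff, map_sum]
  have h : ∀ i ∈ Finset.range p, PowerSeries.constantCoeff (((1 + PowerSeries.X : IwasawaAlgebraO S) ^ p ^ n) ^ i) = 1 := fun i _ ↦ by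
    rw [map_pow, map_pow, map_add, map_one, PowerSeries.constantCoeff_X, add_zero, one_pow, one_pow]
  rw [Finset.sum_congr rfl h, Finset.sum_const, Finset.card_range, nsmul_eq_mul, mul_one]
  rw [padicCoeffIntegers_eq_unitBall S]
  exact Literature.NumberTheory.Automorphic.PadicIntermediateField.not_isUnit_natCast_prime p _

/-- **`ω_n ∈ 𝔪^{n+1}`** (`ω_0 = T`, `ω_{n+1} = ω_n · (non-unit)`). [cite: Washington1997, §7.1] [cite: NeukirchSchmidtWingberg2008, (5.3.5)] -/
theorem omegaT_mem_maximalIdeal_pow (n : ℕ) : haveI := isLocalRing_padicCoeffIntegers S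
    omegaT S n ∈ IsLocalRing.maximalIdeal (IwasawaAlgebraO S) ^ (n + 1) := by
  haveI := isLocalRing_padicCoeffIntegers S
  induction n with
  | zero =>
    rw [zero_add, pow_one, omegaT, pow_zero, pow_one, add_sub_cancel_left, IsLocalRing.mem_maximalIdeal, mem_nonunits_iff, PowerSeries.isUnit_iff_constantCoeff,
      PowerSeries.constantCoeff_X]
    exact not_isUnit_zero
  | succ n ih =>
    rw [omegaT_succ, pow_succ]
    exact Ideal.mul_mem_mul ih (geom_sum_mem_maximalIdeal S n)

/-- `(p^m, ω_m) ⊆ 𝔪^m`. [cite: NeukirchSchmidtWingberg2008, (5.3.5)] -/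
theorem span_pair_le_maximalIdeal_pow (m : ℕ) : haveI := isLocalRing_padicCoeffIntegers S
    Ideal.span {PowerSeries.C (((p : ℕ) : padicCoeffIntegers S) ^ m), omegaT S m} ≤ IsLocalRing.maximalIdeal (IwasawaAlgebraO S) ^ m := by
  haveI := isLocalRing_padicCoeffIntegers S
  rw [Ideal.span_le]
  rintro x (rfl | rfl)
  · rw [SetLike.mem_coe, map_pow]
    exact Ideal.pow_mem_pow (C_natCast_mem_maximalIdeal S) m
  · exact Ideal.pow_le_pow_right (Nat.le_succ m) (omegaT_mem_maximalIdeal_pow S m)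

variable [FiniteDimensional ℚ_[p] (padicCoeffField S)]

/-- ★★ **Krull along the tower: `⋂_m (I + (p^m, ω_m)) = I`** for every ideal `I` of `Λ_𝒪` — `Λ_𝒪` is Noetherian local, `(p^m, ω_m) ⊆ 𝔪^m`, and `⋂_m 𝔪^m (Λ_𝒪/I) = 0` (Krull's intersection
theorem for the finitely generated module `Λ_𝒪/I`). [cite: Matsumura1987, Thm. 8.10] [cite: Washington1997, §13.2] -/
theorem iInf_sup_span_pair_eq (I : Ideal (IwasawaAlgebraO S)) :
    ⨅ m : ℕ, I ⊔ Ideal.span {PowerSeries.C (((p : ℕ) : padicCoeffIntegers S) ^ m), omegaT S m} = I := by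
  haveI := isLocalRing_padicCoeffIntegers S
  haveI : IsPrincipalIdealRing (padicCoeffIntegers S) := isPrincipalIdealRing_padicCoeffIntegers S
  refine le_antisymm (fun x hx ↦ ?_) (le_iInf fun m ↦ le_sup_left)
  rw [Ideal.mem_iInf] at hx
  -- the image of `x` in `Λ_𝒪/I` lies in every `𝔪^m (Λ_𝒪/I)`
  have hmem : ∀ m : ℕ, (Ideal.Quotient.mk I x) ∈ (IsLocalRing.maximalIdeal (IwasawaAlgebraO S) ^ m • ⊤ : Submodule (IwasawaAlgebraO S) (IwasawaAlgebraO S ⧸ I)) := by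
    intro m
    obtain ⟨i, hi, j, hj, hij⟩ := Submodule.mem_sup.mp (hx m)
    have hj' : j ∈ IsLocalRing.maximalIdeal (IwasawaAlgebraO S) ^ m := span_pair_le_maximalIdeal_pow S m hj
    have hxj : Ideal.Quotient.mk I x = j • Ideal.Quotient.mk I 1 := by
      rw [← hij, map_add, Ideal.Quotient.eq_zero_iff_mem.mpr hi, zero_add]
      change Submodule.Quotient.mk j = j • Submodule.Quotient.mk (1 : IwasawaAlgebraO S)
      rw [← Submodule.Quotient.mk_smul, smul_eq_mul, mul_one]
    rw [hxj]
    exact Submodule.smul_mem_smul hj' Submodule.mem_top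
  have h0 : Ideal.Quotient.mk I x = 0 :=
    IsHausdorff.haus (I := IsLocalRing.maximalIdeal (IwasawaAlgebraO S)) inferInstance _ fun m ↦ SModEq.zero.mpr (hmem m)
  exact Ideal.Quotient.eq_zero_iff_mem.mp h0

/-- ★★ **The double-tower form: `⋂_{n,k} (I + (p^k, ω_n)) = I`.** (The levels `(n,k)` of the semilocal Iwasawa modules are killed by `p^k` and by `ω_n`.) [cite: Matsumura1987, Thm. 8.10]
[cite: Washington1997, §13.2] -/
theorem iInf_iInf_sup_span_pair_eq (I : Ideal (IwasawaAlgebraO S)) :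
    ⨅ n : ℕ, ⨅ k : ℕ, I ⊔ Ideal.span {PowerSeries.C (((p : ℕ) : padicCoeffIntegers S) ^ k), omegaT S n} = I := by
  refine le_antisymm ?_ (le_iInf fun n ↦ le_iInf fun k ↦ le_sup_left)
  calc ⨅ n : ℕ, ⨅ k : ℕ, I ⊔ Ideal.span {PowerSeries.C (((p : ℕ) : padicCoeffIntegers S) ^ k), omegaT S n}
      ≤ ⨅ m : ℕ, I ⊔ Ideal.span {PowerSeries.C (((p : ℕ) : padicCoeffIntegers S) ^ m), omegaT S m} :=
        le_iInf fun m ↦ (iInf_le _ m).trans (iInf_le _ m)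
    _ = I := iInf_sup_span_pair_eq S I

end Summit.BirchSwinnertonDyer.BirchSwinnertonDyer.Theorems.SmallImageRttD2Seq

end
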